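import Literature.IUT.HodgeTheaters.DiscreteProfiniteConjugatesSplitting
import Literature.GroupTheory.CombinatorialGroupTheory.FreeFactorFiniteIndex
import HarnessLib

/-!
# [IUTchI] Lemma 2.7 (ii)/(iii), free case, SPLIT forms — unconditional

Mochizuki, *Inter-universal Teichmüller theory I*, kurims manuscript (May 2020), §2, Lemma 2.7,
pp. 57–59 [cite: Mochizuki2012, Lem 2.7 pp.57-59].  PROOF-ONLY; no new definitions.  The file
`DiscreteProfiniteConjugatesSplitting.lean` proves the split forms of Lemma 2.7 (ii)/(iii) for free
groups — "`H_G ↪ G ↠ Gᵃᵇ` is a split injection" after passing to a finite index subgroup (p. 57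
l. 1–3), "`M ↪ Gᵃᵇ` splits", `M = ℤ[x] ⊕ ℤ[y]` (p. 57 l. 13–15; p. 59, `β : G₁ ↠ ℤ × ℤ`,
`β(x) = (1,0)`, `β(y) = (0,1)`) — modulo M. Hall's theorem in free-factor form, taken there as an
explicit hypothesis.  That hypothesis is now the tree's theorem
`Literature.GroupTheory.CombinatorialGroupTheory.FreeFactor.exists_finiteIndex_freeFactor`
(abc-iut-L5-t16, `FreeFactorFiniteIndex.lean`), so the split forms hold unconditionally:

* `exists_finiteIndex_hom_singleton` — `h ≠ 1` in a free group ⇒ `∃` finite-index `K ∋ h`,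
  `β : K → ℤ` with `β h = 1`;
* `exists_finiteIndex_hom_pair` — `x, y` non-commuting ⇒ `∃` finite-index `K ∋ x, y`,
  `β : K → ℤ × ℤ` with `β x = (1, 0)`, `β y = (0, 1)`.
-/

namespace Literature.IUT.HodgeTheaters

namespace FreeOrSurface

open Literature.GroupTheory.CombinatorialGroupTheory

universe u

/-- **Split form of Lemma 2.7 (ii), free case, unconditional**: for `h ≠ 1` in a free group there are
a finite index subgroup `K ∋ h` and a homomorphism `β : K → ℤ` with `β(h) = 1` (p. 57 l. 1–3).
[cite: Mochizuki2012, Lem 2.7(ii) p.57] -/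
theorem exists_finiteIndex_hom_singleton {G : Type u} [Group G] [IsFreeGroup G] {h : G}
    (hh : h ≠ 1) :
    ∃ (K : Subgroup G) (hk : h ∈ K), K.FiniteIndex ∧
      ∃ β : K →* Multiplicative ℤ, β ⟨h, hk⟩ = Multiplicative.ofAdd 1 :=
  exists_finiteIndex_split_singleton (fun H hH => FreeFactor.exists_finiteIndex_freeFactor H hH) hh

/-- **Split form of Lemma 2.7 (iii), free case, unconditional**: for non-commuting `x, y` in a free
group there are a finite index subgroup `K ∋ x, y` and a homomorphism `β : K → ℤ × ℤ` with
`β(x) = (1, 0)`, `β(y) = (0, 1)` (p. 57 l. 13–15; p. 59). [cite: Mochizuki2012, Lem 2.7(iii) p.57] -/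
theorem exists_finiteIndex_hom_pair {G : Type u} [Group G] [IsFreeGroup G] {x y : G}
    (hxy : x * y ≠ y * x) :
    ∃ (K : Subgroup G) (hx : x ∈ K) (hy : y ∈ K), K.FiniteIndex ∧
      ∃ β : K →* Multiplicative ℤ × Multiplicative ℤ,
        β ⟨x, hx⟩ = (Multiplicative.ofAdd 1, 1) ∧ β ⟨y, hy⟩ = (1, Multiplicative.ofAdd 1) :=
  exists_finiteIndex_split_pair (fun H hH => FreeFactor.exists_finiteIndex_freeFactor H hH) hxy

end FreeOrSurface

end Literature.IUT.HodgeTheaters
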